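import Mathlib
import Summits.Ventures.PercRepro2.KPrimeReduction
import Summits.Ventures.PercRepro2.KPrimeBase
import Summits.Ventures.PercRepro2.KPrimeSure
import Summits.Ventures.PercRepro2.KPrimeEdgeSteps

/-!
# The `a₂`-frontier induction for `(K′)`: `(STEP′) ⟹ (K′)` — `KPrime.kprime_of_step`
(blind cell PercRepro2, mine-c g32; `conjectures/MINE-C.md` §41.3; `proofs/MINEC-KPRIME-INDUCTION.md`)

The lemma of record `(K′)` (`KPrime.kprimeForm`, `KPrimeReduction.lean`) follows from the ONE-EDGE
implication `(STEP′)`: exploring an unresolved edge `e = {x, z}` at the weight-`1` root of `a₂`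
(`x ∈ root`, `z ∉ root`, `z ∉ {a₁, v}`, `p e ∉ {0, 1}`) by pinning it closed (`p[e ↦ 0]`) or open
(`p[e ↦ 1]`) keeps `(K′)`:

  `(STEP′)  (K′)(p[e ↦ 0]) → (K′)(p[e ↦ 1]) → (K′)(p)`.

**Theorem** (`kprime_of_step`): `(STEP′)` for every instance implies `(K′)` for every instance, by
strong induction on the number of unresolved edges (weight different from `0` and `1`): an
unresolved root edge is resolved by `(STEP′)`; an unresolved edge from the root into `a₁` / `v` by
`kprimeHolds_of_update_zero_a₁` / `_v` (`KPrimeEdgeSteps.lean`); when none is left the root is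
exhausted and the base cases of `KPrimeSure.lean` apply.

`(STEP′)` is NOT proved here.  It would follow from the one-edge inequality `(STEP-K′)` of
`MINE-C.md` §40.8 (the brace `≥ 0`) through the exact frontier identity — but `(STEP-K′)` is FALSE
(mine-c g32, `MINE-C.md` §41.2: an adversarial weight climb found exact negative steps at
`n = 7, 8, 10`, e.g. `c7_00112` with 9 edges; `(K′)` itself holds at every witness).  So this file
is the kernel form of the induction FRAME — `(K′)` follows from the one-edge implication
`(STEP′)` — whose base case, degenerate cases and two edge steps are unconditional; a proof of
`(K′)` by this frame needs a strengthened inductive potential.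
-/

namespace Summit.Ventures.PercRepro2

namespace KPrime

variable {V : Type*} {E : Type*} [Fintype E] [DecidableEq E] [Fintype V] [DecidableEq V]
  {R : Type*} [Field R] [LinearOrder R] [IsStrictOrderedRing R]

/-! ## The induction: `(STEP′) ⟹ (K′)` -/

section Induction

variable (ends : E → Sym2 V) (a₁ a₂ b v y : V)

/-- The number of unresolved edges: weights different from `0` and `1`. -/
def unres (p : E → R) : ℕ := (Finset.univ.filter (fun e => p e ≠ 0 ∧ p e ≠ 1)).card

omit [Fintype V] [DecidableEq V] [IsStrictOrderedRing R] in
/-- Resolving an unresolved edge lowers the count. -/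
lemma unres_update_lt {p : E → R} {e : E} (h0 : p e ≠ 0) (h1 : p e ≠ 1) {c : R}
    (hc : c = 0 ∨ c = 1) : unres (Function.update p e c) < unres p := by
  unfold unres
  have hfilt : (Finset.univ.filter
      (fun f => Function.update p e c f ≠ 0 ∧ Function.update p e c f ≠ 1)) =
      (Finset.univ.filter (fun f => p f ≠ 0 ∧ p f ≠ 1)).erase e := by
    ext f
    simp only [Finset.mem_filter, Finset.mem_univ, true_and, Finset.mem_erase]
    by_cases hf : f = e
    · subst hf
      rcases hc with rfl | rfl <;> simp
    · simp [hf]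
  rw [hfilt]
  exact Finset.card_erase_lt_of_mem (by simp [h0, h1])

/-- An UNRESOLVED ROOT EDGE: `e = {x, z}` with `x` in the weight-`1` root of `a₂`, `z` outside
the root and `z ∉ {a₁, v}`, and `p e ∉ {0, 1}` — the edges the `a₂`-frontier exploration resolves
(`MINE-C.md` §40.8: the root edges `(a₂, z)`, `z ∉ {a₁, v}`, of the contracted multigraph). -/
def IsUnresolvedRootEdge (p : E → R) (e : E) : Prop :=
  ∃ x z, ends e = s(x, z) ∧ x ∈ root p ends a₂ ∧ z ∉ root p ends a₂ ∧ z ≠ a₁ ∧ z ≠ v ∧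
    p e ≠ 0 ∧ p e ≠ 1

/-- **(STEP′)** — the one-edge statement of the `a₂`-frontier induction: at every instance and
every unresolved root edge `e`, `(K′)` for the two resolutions (`e` pinned closed / pinned open)
implies `(K′)` for the instance.  NOT proved here; the brace inequality `(STEP-K′)` that would
imply it (`MINE-C.md` §40.8) is FALSE (§41.2), so `(STEP′)` needs a strengthened potential. -/
def StepK : Prop :=
  ∀ p : E → R, IsProbVec p → ∀ e, IsUnresolvedRootEdge ends a₁ a₂ v p e →
    KPrimeHolds ends a₁ a₂ b v y (Function.update p e 0) →
      KPrimeHolds ends a₁ a₂ b v y (Function.update p e 1) →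
        KPrimeHolds ends a₁ a₂ b v y p

/-- **THE `a₂`-FRONTIER INDUCTION**: `(STEP′)` for every instance implies `(K′)` for every
instance (`proofs/MINEC-KPRIME-INDUCTION.md` §3, kernel form).  Induction on the number of
unresolved edges: an unresolved root edge is resolved by `(STEP′)`; an unresolved edge from the
root into `a₁` (resp. `v`) by `kprimeHolds_of_update_zero_a₁` (resp. `_v`); when none is left the
root is exhausted and `kprime_of_exhausted` / `kprime_of_exhausted_y` (resp. the degenerate cases
`a₁ ∈ root`, `v ∈ root`) apply. -/
theorem kprime_of_step (hstep : StepK (R := R) ends a₁ a₂ b v y) :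
    ∀ p : E → R, IsProbVec p → KPrimeHolds ends a₁ a₂ b v y p := by
  intro p
  induction' hn : unres p using Nat.strong_induction_on with n ih generalizing p
  intro hp
  by_cases hre : ∃ e, IsUnresolvedRootEdge ends a₁ a₂ v p e
  · obtain ⟨e, x, z, hends, hx, hz, hz1, hzv, h0, h1⟩ := hre
    have ih0 := ih _ (hn ▸ unres_update_lt h0 h1 (Or.inl rfl)) (Function.update p e 0) rfl
      (hp.update e le_rfl zero_le_one)
    have ih1 := ih _ (hn ▸ unres_update_lt h0 h1 (Or.inr rfl)) (Function.update p e 1) rfl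
      (hp.update e zero_le_one le_rfl)
    exact hstep p hp e ⟨x, z, hends, hx, hz, hz1, hzv, h0, h1⟩ ih0 ih1
  simp only [not_exists] at hre
  by_cases h1r : a₁ ∈ root p ends a₂
  · exact kprimeHolds_of_a₁_mem_root h1r
  by_cases hvr : v ∈ root p ends a₂
  · exact kprimeHolds_of_v_mem_root hvr
  by_cases hea : ∃ e x, ends e = s(x, a₁) ∧ x ∈ root p ends a₂ ∧ p e ≠ 0 ∧ p e ≠ 1
  · obtain ⟨e, x, hends, hx, h0, h1⟩ := hea
    have ih0 := ih _ (hn ▸ unres_update_lt h0 h1 (Or.inl rfl)) (Function.update p e 0) rfl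
      (hp.update e le_rfl zero_le_one)
    exact kprimeHolds_of_update_zero_a₁ hp hends hx h1 ih0
  by_cases hev : ∃ e x, ends e = s(x, v) ∧ x ∈ root p ends a₂ ∧ p e ≠ 0 ∧ p e ≠ 1
  · obtain ⟨e, x, hends, hx, h0, h1⟩ := hev
    have ih0 := ih _ (hn ▸ unres_update_lt h0 h1 (Or.inl rfl)) (Function.update p e 0) rfl
      (hp.update e le_rfl zero_le_one)
    exact kprimeHolds_of_update_zero_v hp hends hx h1 ih0
  have hex : Exhausted p ends a₂ := by
    intro e x z hends hx hz
    by_contra h0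
    have h1 : p e ≠ 1 := fun h1 => hz (mem_root_of_one p hends hx h1)
    by_cases hz1 : z = a₁
    · subst hz1; exact hea ⟨e, x, hends, hx, h0, h1⟩
    by_cases hzv : z = v
    · subst hzv; exact hev ⟨e, x, hends, hx, h0, h1⟩
    exact hre e ⟨x, z, hends, hx, hz, hz1, hzv, h0, h1⟩
  by_cases hyr : y ∈ root p ends a₂
  · exact kprime_of_exhausted_y hex h1r hvr hyr
  · exact kprime_of_exhausted hp hex h1r hvr hyr

end Induction

end KPrime

end Summit.Ventures.PercRepro2
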